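import Summits.Ventures.PercRepro.S2RankClasses

/-!
# PercRepro — S2: THE CRUDE COUNTS OF THE DEPENDENT `4`-SETS AND OF THE CIRCUITS THROUGH ONE DELETION (p7, gen 18; sub-claim S2; tools for the
row `p = 13` at corank `≥ 9`)

**`ncard_dep_four_le`** — the dependent `4`-sets of a loopless finite matroid of dual rank `ν` contain a `2`-circuit, a `3`-circuit or are
`4`-circuits: at most `C(ν + 1, 2)·C(|E| − 2, 2) + C(ν + 2, 3)·(|E| − 3) + C(ν + 3, 4)` (the kit's circuit count).
**`ncard_circuits_mul_le_of_forall_not_isColoop`** — in a coloop-free matroid every `(k + 1)`-circuit avoids `|E| − (k + 1)` points and the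
circuits avoiding a point `e` are those of `N ＼ e`, of dual rank `ν − 1`: `(|E| − (k + 1)) · #{(k+1)-circuits} ≤ |E| · C(ν + k − 1, k + 1)`
(a double count of the pairs (circuit, point outside it)). Nothing about any cell is claimed. Axioms: standard.
-/

open scoped Matroid

namespace PercRepro

namespace S2

open Set

variable {α : Type}

/-- **The dependent `4`-sets of a loopless finite matroid** with `N✶.eRank = ν`: at most
`C(ν + 1, 2)·C(|E| − 2, 2) + C(ν + 2, 3)·(|E| − 3) + C(ν + 3, 4)`. -/
theorem ncard_dep_four_le (N : Matroid α) [N.Finite] {ν : ℕ} (hν : N✶.eRank = (ν : ℕ∞))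
    (hL : ∀ e ∈ N.E, ¬ N.IsLoop e) :
    {X : Set α | X ⊆ N.E ∧ X.ncard = 4 ∧ N.Dep X}.ncard ≤
      (ν + 1).choose 2 * (N.E.ncard - 2).choose 2 + (ν + 2).choose 3 * (N.E.ncard - 3) + (ν + 3).choose 4 := by
  classical
  set A2 : Set (Set α) := ⋃ C ∈ Matroid.circF N 2, {X : Set α | X ⊆ N.E ∧ X.ncard = 4 ∧ C ⊆ X} with hA2
  set A3 : Set (Set α) := ⋃ C ∈ Matroid.circF N 3, {X : Set α | X ⊆ N.E ∧ X.ncard = 4 ∧ C ⊆ X} with hA3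
  have hcover : {X : Set α | X ⊆ N.E ∧ X.ncard = 4 ∧ N.Dep X} ⊆ A2 ∪ A3 ∪ {C : Set α | N.IsCircuit C ∧ C.ncard = 4} := by
    rintro X ⟨hXE, hX4, hXdep⟩
    have hXfin : X.Finite := N.ground_finite.subset hXE
    obtain ⟨C, hCX, hC⟩ := hXdep.exists_isCircuit_subset
    have hCfin : C.Finite := hXfin.subset hCX
    have hC4 : C.ncard ≤ 4 := by
      have := Set.ncard_le_ncard hCX hXfin
      omega
    have hC1 : C.ncard ≠ 1 := by
      intro h1
      obtain ⟨e, rfl⟩ := Set.ncard_eq_one.1 h1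
      exact hL e (hC.subset_ground (Set.mem_singleton e)) (Matroid.singleton_isCircuit.1 hC)
    have hC0 : C.ncard ≠ 0 := by
      intro h0
      rw [Set.ncard_eq_zero hCfin] at h0
      exact hC.nonempty.ne_empty h0
    rcases (show C.ncard = 2 ∨ C.ncard = 3 ∨ C.ncard = 4 by omega) with h | h | h
    · exact Or.inl (Or.inl (Set.mem_iUnion₂.2 ⟨C, Matroid.mem_circF.2 ⟨hC, h⟩, hXE, hX4, hCX⟩))
    · exact Or.inl (Or.inr (Set.mem_iUnion₂.2 ⟨C, Matroid.mem_circF.2 ⟨hC, h⟩, hXE, hX4, hCX⟩))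
    · have hCeq : C = X := Set.eq_of_subset_of_ncard_le hCX (by omega) hXfin
      exact Or.inr ⟨hCeq ▸ hC, hX4⟩
  have hA2fin : A2.Finite := N.ground_finite.finite_subsets.subset (fun X hX => by
    obtain ⟨C, -, hX⟩ := Set.mem_iUnion₂.1 hX
    exact hX.1)
  have hA3fin : A3.Finite := N.ground_finite.finite_subsets.subset (fun X hX => by
    obtain ⟨C, -, hX⟩ := Set.mem_iUnion₂.1 hX
    exact hX.1)
  have h4fin : {C : Set α | N.IsCircuit C ∧ C.ncard = 4}.Finite :=
    N.ground_finite.finite_subsets.subset (fun C hC => hC.1.subset_ground)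
  have hA2le : A2.ncard ≤ {C : Set α | N.IsCircuit C ∧ C.ncard = 2}.ncard * (N.E.ncard - 2).choose 2 := by
    calc A2.ncard ≤ ∑ C ∈ Matroid.circF N 2, {X : Set α | X ⊆ N.E ∧ X.ncard = 4 ∧ C ⊆ X}.ncard :=
          Finset.set_ncard_biUnion_le (Matroid.circF N 2) _
      _ ≤ ∑ _C ∈ Matroid.circF N 2, (N.E.ncard - 2).choose 2 := by
          refine Finset.sum_le_sum (fun C hC => ?_)
          obtain ⟨hCc, hC2⟩ := Matroid.mem_circF.1 hC
          have h := ncard_subsets_superset_le N hCc.subset_ground 4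
          rw [hC2] at h
          exact h
      _ = {C : Set α | N.IsCircuit C ∧ C.ncard = 2}.ncard * (N.E.ncard - 2).choose 2 := by
          rw [Finset.sum_const, smul_eq_mul, Matroid.card_circF]
  have hA3le : A3.ncard ≤ {C : Set α | N.IsCircuit C ∧ C.ncard = 3}.ncard * (N.E.ncard - 3) := by
    calc A3.ncard ≤ ∑ C ∈ Matroid.circF N 3, {X : Set α | X ⊆ N.E ∧ X.ncard = 4 ∧ C ⊆ X}.ncard :=
          Finset.set_ncard_biUnion_le (Matroid.circF N 3) _
      _ ≤ ∑ _C ∈ Matroid.circF N 3, (N.E.ncard - 3) := by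
          refine Finset.sum_le_sum (fun C hC => ?_)
          obtain ⟨hCc, hC3⟩ := Matroid.mem_circF.1 hC
          have h := ncard_subsets_superset_le N hCc.subset_ground 4
          rw [hC3] at h
          exact h.trans (by rw [Nat.choose_one_right])
      _ = {C : Set α | N.IsCircuit C ∧ C.ncard = 3}.ncard * (N.E.ncard - 3) := by
          rw [Finset.sum_const, smul_eq_mul, Matroid.card_circF]
  have hc2 := Matroid.ncard_circuits_le_choose N hν 1
  have hc3 := Matroid.ncard_circuits_le_choose N hν 2
  have hc4 := Matroid.ncard_circuits_le_choose N hν 3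
  norm_num at hc2 hc3 hc4
  have hu := Set.ncard_le_ncard hcover ((hA2fin.union hA3fin).union h4fin)
  have hu1 := Set.ncard_union_le (A2 ∪ A3) {C : Set α | N.IsCircuit C ∧ C.ncard = 4}
  have hu2 := Set.ncard_union_le A2 A3
  calc {X : Set α | X ⊆ N.E ∧ X.ncard = 4 ∧ N.Dep X}.ncard
      ≤ A2.ncard + A3.ncard + {C : Set α | N.IsCircuit C ∧ C.ncard = 4}.ncard := by omega
    _ ≤ {C : Set α | N.IsCircuit C ∧ C.ncard = 2}.ncard * (N.E.ncard - 2).choose 2 +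
          {C : Set α | N.IsCircuit C ∧ C.ncard = 3}.ncard * (N.E.ncard - 3) + (ν + 3).choose 4 := by gcongr
    _ ≤ (ν + 1).choose 2 * (N.E.ncard - 2).choose 2 + (ν + 2).choose 3 * (N.E.ncard - 3) + (ν + 3).choose 4 := by gcongr

/-- **The circuits of a coloop-free matroid through one deletion**: every `(k + 1)`-circuit avoids `|E| − (k + 1)` points, and the
circuits avoiding a point `e` are the circuits of `N ＼ e` (dual rank `ν` when `N✶.eRank = ν + 1`), at most `C(ν + k, k + 1)`; so
`#{(k+1)-circuits} · (|E| − (k + 1)) ≤ |E| · C(ν + k, k + 1)`. -/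
theorem ncard_circuits_mul_le_of_forall_not_isColoop (N : Matroid α) [N.Finite] {ν : ℕ}
    (hν : N✶.eRank = ((ν + 1 : ℕ) : ℕ∞)) (hK : ∀ e, ¬ N.IsColoop e) (k : ℕ) :
    {C : Set α | N.IsCircuit C ∧ C.ncard = k + 1}.ncard * (N.E.ncard - (k + 1)) ≤ N.E.ncard * (ν + k).choose (k + 1) := by
  classical
  set S := Matroid.circF N (k + 1) with hS
  set Ef : Finset α := N.ground_finite.toFinset with hEf
  have hEfcard : Ef.card = N.E.ncard := (Set.ncard_eq_toFinset_card _ N.ground_finite).symm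
  -- the double count
  have key : ∑ C ∈ S, (Ef.filter (fun e => e ∉ C)).card = ∑ e ∈ Ef, (S.filter (fun C => e ∉ C)).card := by
    simp only [Finset.card_filter]
    exact Finset.sum_comm
  -- each circuit avoids `|E| − (k + 1)` points
  have hleft : ∀ C ∈ S, (Ef.filter (fun e => e ∉ C)).card = N.E.ncard - (k + 1) := by
    intro C hC
    obtain ⟨hCc, hCk⟩ := Matroid.mem_circF.1 hC
    have hCE : C ⊆ N.E := hCc.subset_ground
    have hCfin : C.Finite := N.ground_finite.subset hCE
    have h1 : (Ef.filter (fun e => e ∈ C)).card = k + 1 := by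
      have : Ef.filter (fun e => e ∈ C) = hCfin.toFinset := by
        ext e
        simp only [Finset.mem_filter, hEf, Set.Finite.mem_toFinset]
        exact ⟨fun h => h.2, fun h => ⟨hCE h, h⟩⟩
      rw [this, ← Set.ncard_eq_toFinset_card _ hCfin, hCk]
    have h2 := Finset.card_filter_add_card_filter_not (s := Ef) (fun e => e ∈ C)
    rw [h1, hEfcard] at h2
    omega
  -- the circuits avoiding `e` are circuits of `N ＼ e`
  have hright : ∀ e ∈ Ef, (S.filter (fun C => e ∉ C)).card ≤ (ν + k).choose (k + 1) := by
    intro e he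
    have heE : e ∈ N.E := by simpa [hEf] using he
    have hν' : (N ＼ {e})✶.eRank = (ν : ℕ∞) := eRank_dual_delete_singleton N hν heE (hK e)
    have hkit := Matroid.ncard_circuits_le_choose (N ＼ {e}) hν' k
    have hsub : ((S.filter (fun C => e ∉ C) : Finset (Set α)) : Set (Set α)) ⊆
        {C : Set α | (N ＼ {e}).IsCircuit C ∧ C.ncard = k + 1} := by
      intro C hC
      rw [Finset.mem_coe, Finset.mem_filter] at hC
      obtain ⟨hCc, hCk⟩ := Matroid.mem_circF.1 hC.1
      refine ⟨?_, hCk⟩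
      rw [Matroid.delete_isCircuit_iff]
      exact ⟨hCc, Set.disjoint_singleton_right.2 hC.2⟩
    have h := Set.ncard_le_ncard hsub ((N ＼ {e}).ground_finite.finite_subsets.subset (fun C hC => hC.1.subset_ground))
    rw [Set.ncard_coe_finset] at h
    exact h.trans hkit
  calc {C : Set α | N.IsCircuit C ∧ C.ncard = k + 1}.ncard * (N.E.ncard - (k + 1))
      = S.card * (N.E.ncard - (k + 1)) := by rw [hS, Matroid.card_circF]
    _ = ∑ C ∈ S, (Ef.filter (fun e => e ∉ C)).card := by
        rw [Finset.sum_congr rfl hleft, Finset.sum_const, smul_eq_mul]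
    _ = ∑ e ∈ Ef, (S.filter (fun C => e ∉ C)).card := key
    _ ≤ ∑ _e ∈ Ef, (ν + k).choose (k + 1) := Finset.sum_le_sum hright
    _ = N.E.ncard * (ν + k).choose (k + 1) := by rw [Finset.sum_const, smul_eq_mul, hEfcard]

end S2

end PercRepro
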